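import Summits.QuantumFields.YangMills.Theorems.BalabanUVNodesN15KingModelLandauFibre
import Mathlib.Data.ZMod.ValMinAbs
import Mathlib.Analysis.SpecialFunctions.Complex.CircleAddChar
import Mathlib.Algebra.Order.Interval.Finset.Basic
import Mathlib.Data.Int.Interval
import HarnessLib

/-!
# BalabanUVNodes ∕ N15 — THE KING-MODEL RUNG (PART Ϡ-f): THE TENT TRIAL PROFILE ON THE CYCLE — the cycle distance `cycD j = |valMinAbs j|` on `ℤ∕N`, the Harper potential as a cosine of the
# signed distance (`Re ψ(p₀j) = cos(θ·valMinAbs j)`, hence `2 − 2Re ψ(p₀j) ≤ θ²cycD(j)²`), and the tent `max(0, ℓ − cycD j)`: `1`-Lipschitz, mass `≥ ℓ³∕3`, kinetic energy `≤ 2ℓ+1`,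
# potential energy `≤ θ²ℓ²·mass` — the ingredients of the variational UPPER bound of PART Ϡ-g (two-sided Landau scaling)
# (Track A, DAG node N15 = NE2; FAN-OUT v1.1 §N15 s3 «KING-MODEL RUNG … + what the curved case adds»; count-neutral)

HONEST FRAMING.  Count-neutral (cell `pub-ymgap`, seat `pub-ymgap-dag-n15-e` g47; `--supports stmt-QuantumFields-27247 --as helper` = K3ᴬ, KEY MAP v3).  Elementary arithmetic on `ℤ∕N`
(Mathlib's `ZMod.valMinAbs`) and the standard character; no operator appears here (the consumer is PART Ϡ-g, which reads these along a `ν₀`-cycle of King's torus for King's covariant fine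
operator [King1986] (4.4) p.670 at the constant-flux field).  NOT Bałaban's `G_k(U)`; NOT a node discharge; nothing continuum ∕ ℝ⁴ ∕ OS ∕ Clay.

THE RESULTS (`N ≥ 1`, `ψ = stdAddChar` of `ℤ∕N`, `ψ(p₀) = e^{iθ}`):
* §1 `cycD` (def), `cycD_neg`, `cycD_zero`, `cycD_natCast` (`= i` for `i ≤ N∕2`), `cycD_one_le`, ★ `cycD_succ_le` ∕ ★ `cycD_le_succ` (`|cycD(j+1) − cycD j| ≤ 1`, from
  `ZMod.natAbs_valMinAbs_add_le`), ★ `re_stdAddChar_mul_eq_cos` (`Re ψ(p₀·j) = cos(θ·valMinAbs j)`, `AddChar.map_zsmul_eq_zpow` + `Complex.exp_int_mul`), ★★ **`two_sub_two_re_stdAddChar_le`**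
  (`2 − 2Re ψ(p₀j) ≤ θ²·cycD(j)²`: the Harper potential is at most quadratic in the cycle distance to its well).
* §2 `tent ℓ` (def `max(0, ℓ − cycD j)`), `tent_nonneg`, `abs_tent_succ_sub_le` (`1`-Lipschitz), `tent_eq_zero_of`, `tent_le`, `tent_natCast`, `sum_succ_sq_ge` ∕ `sum_sq_sub_ge` (`3Σ_{i<ℓ}(ℓ−i)² ≥ ℓ³`),
  ★★ **`sum_tent_sq_ge`** (mass `≥ ℓ³∕3`, `ℓ ≤ N∕2`), ★★ **`sum_tent_fwdDiff_sq_le`** (kinetic energy `≤ 2ℓ+1`: the window `cycD ≤ ℓ` is the image of `[−ℓ,ℓ] ⊂ ℤ`), ★★ **`sum_potential_tent_sq_le`**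
  (`Σ(2−2Re ψ(p₀j))tent² ≤ θ²ℓ²·Σtent²`).
PRIOR TREE ART (by name): Ϡ-a (`norm_sq_one_sub_of_norm_eq_one`, import only), Mathlib (`ZMod.valMinAbs`, `ZMod.natAbs_valMinAbs_add_le`, `ZMod.natAbs_valMinAbs_neg`, `ZMod.natAbs_valMinAbs_le`,
`ZMod.valMinAbs_natCast_of_le_half`, `ZMod.coe_valMinAbs`, `ZMod.val_natCast_of_lt`, `AddChar.map_zsmul_eq_zpow`, `Complex.exp_int_mul`, `Complex.exp_ofReal_mul_I_re`, `Finset.sum_range_reflect`,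
`Int.card_Icc`, `Real.one_sub_sq_div_two_le_cos`).  Dedup (rg at filing): basename 0 files; needles `cycD|tent ` (decl names `tent_*`, `cycD_*`) 0 tree files in this namespace; Mathlib has no `cycD`∕`tent`.
Locators: [King1986] (2.12) p.653 (plaquette phases), (4.4) p.670; [Balaban1984PropagatorsI] (1.29) p.23 (characters); [HornJohnson2013] Thm 4.2.2 (the consumer's Rayleigh step).  0 `sorry`, 2 `def`.
-/

noncomputable section
open scoped BigOperators ComplexConjugate
open Finset

namespace Summit.QuantumFields.YangMills.BalabanUVNodes.N15KingModelRung.Landau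

/-! ## §1 The cycle distance and the Harper potential -/

section Cycle

variable {N : ℕ} [NeZero N]

/-- THE CYCLE DISTANCE TO `0` on `ℤ∕N`: `|valMinAbs j| = min(val j, N − val j)`. [folklore] -/
def cycD (j : ZMod N) : ℕ := j.valMinAbs.natAbs

omit [NeZero N] in
/-- `cycD(−j) = cycD(j)`. [folklore] -/
theorem cycD_neg (j : ZMod N) : cycD (-j) = cycD j := ZMod.natAbs_valMinAbs_neg j

omit [NeZero N] in
/-- `cycD 0 = 0`. [folklore] -/
theorem cycD_zero : cycD (0 : ZMod N) = 0 := by simp [cycD, ZMod.valMinAbs_zero]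

omit [NeZero N] in
/-- For `i ≤ N∕2`, `cycD(i) = i`. [folklore] -/
theorem cycD_natCast {i : ℕ} (hi : i ≤ N / 2) : cycD (i : ZMod N) = i := by
  rw [cycD, ZMod.valMinAbs_natCast_of_le_half hi, Int.natAbs_natCast]

/-- `cycD 1 ≤ 1`. [folklore] -/
theorem cycD_one_le : cycD (1 : ZMod N) ≤ 1 := by
  have h := ZMod.natAbs_valMinAbs_le (1 : ZMod N)
  rcases Nat.lt_or_ge 1 N with h1 | h1
  · have : (1 : ZMod N) = ((1 : ℕ) : ZMod N) := by simp
    rw [this, cycD_natCast (by omega)]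
  · have hN : N = 1 := le_antisymm h1 (Nat.one_le_iff_ne_zero.mpr (NeZero.ne N))
    subst hN
    exact h.trans (by norm_num)

/-- ★ ONE STEP CHANGES THE CYCLE DISTANCE BY AT MOST ONE: `cycD(j+1) ≤ cycD(j) + 1`. [folklore] -/
theorem cycD_succ_le (j : ZMod N) : cycD (j + 1) ≤ cycD j + 1 := by
  have h := ZMod.natAbs_valMinAbs_add_le j 1
  unfold cycD
  exact h.trans ((Int.natAbs_add_le _ _).trans (Nat.add_le_add_left cycD_one_le _))

/-- ★ … and `cycD(j) ≤ cycD(j+1) + 1`. [folklore] -/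
theorem cycD_le_succ (j : ZMod N) : cycD j ≤ cycD (j + 1) + 1 := by
  have h := ZMod.natAbs_valMinAbs_add_le (j + 1) (-1)
  rw [add_neg_cancel_right] at h
  unfold cycD
  refine h.trans ((Int.natAbs_add_le _ _).trans (Nat.add_le_add_left ?_ _))
  have := cycD_neg (1 : ZMod N)
  unfold cycD at this
  rw [this]
  exact cycD_one_le

/-- ★ THE HARPER POTENTIAL AS A COSINE OF THE SIGNED DISTANCE: `Re ψ(p₀·j) = cos(θ·valMinAbs j)` with `ψ(p₀) = e^{iθ}`, `θ = 2π·valMinAbs(p₀)∕N`.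
[cite: King1986, (2.12) p.653; Balaban1984PropagatorsI, (1.29) p.23] -/
theorem re_stdAddChar_mul_eq_cos (p₀ j : ZMod N) {θ : ℝ} (hθ : (ZMod.stdAddChar (N := N)) p₀ = Complex.exp (θ * Complex.I)) :
    ((ZMod.stdAddChar (N := N)) (p₀ * j) : ℂ).re = Real.cos (θ * j.valMinAbs) := by
  have hj : p₀ * j = (j.valMinAbs : ℤ) • p₀ := by rw [zsmul_eq_mul, ZMod.coe_valMinAbs, mul_comm]
  rw [hj, AddChar.map_zsmul_eq_zpow, hθ, ← Complex.exp_int_mul]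
  have : (j.valMinAbs : ℂ) * (θ * Complex.I) = ((θ * j.valMinAbs : ℝ) : ℂ) * Complex.I := by push_cast; ring
  rw [this, Complex.exp_ofReal_mul_I_re]

/-- ★ **THE HARPER POTENTIAL IS AT MOST QUADRATIC IN THE CYCLE DISTANCE TO ITS WELL**: `2 − 2·Re ψ(p₀j) ≤ θ²·cycD(j)²`. [cite: King1986, (2.12) p.653] -/
theorem two_sub_two_re_stdAddChar_le (p₀ j : ZMod N) {θ : ℝ} (hθ : (ZMod.stdAddChar (N := N)) p₀ = Complex.exp (θ * Complex.I)) :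
    2 - 2 * ((ZMod.stdAddChar (N := N)) (p₀ * j) : ℂ).re ≤ θ ^ 2 * (cycD j : ℝ) ^ 2 := by
  rw [re_stdAddChar_mul_eq_cos p₀ j hθ]
  have h := Real.one_sub_sq_div_two_le_cos (x := θ * j.valMinAbs)
  have habs : ((cycD j : ℝ)) ^ 2 = (j.valMinAbs : ℝ) ^ 2 := by
    rw [cycD, Nat.cast_natAbs, Int.cast_abs, sq_abs]
  rw [habs]
  nlinarith [h]

end Cycle

/-! ## §2 The tent profile -/

section Tent

variable {N : ℕ} [NeZero N]

/-- THE TENT of half-width `ℓ` centred at `0`: `max(0, ℓ − cycD j)`. [folklore] -/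
def tent (ℓ : ℕ) (j : ZMod N) : ℝ := max 0 ((ℓ : ℝ) - cycD j)

omit [NeZero N] in
/-- `tent ≥ 0`. [folklore] -/
theorem tent_nonneg (ℓ : ℕ) (j : ZMod N) : 0 ≤ tent ℓ j := le_max_left _ _

/-- `|tent(j+1) − tent(j)| ≤ 1` (the tent is `1`-Lipschitz along the cycle). [folklore] -/
theorem abs_tent_succ_sub_le (ℓ : ℕ) (j : ZMod N) : |tent ℓ (j + 1) - tent ℓ j| ≤ 1 := by
  have h1 : (cycD (j + 1) : ℝ) ≤ cycD j + 1 := by exact_mod_cast cycD_succ_le j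
  have h2 : (cycD j : ℝ) ≤ cycD (j + 1) + 1 := by exact_mod_cast cycD_le_succ j
  unfold tent
  rw [abs_le]
  constructor
  · rcases le_total 0 ((ℓ : ℝ) - cycD j) with h | h
    · rw [max_eq_right h]; have := le_max_right 0 ((ℓ : ℝ) - cycD (j + 1)); linarith
    · rw [max_eq_left h]; have := le_max_left 0 ((ℓ : ℝ) - cycD (j + 1)); linarith
  · rcases le_total 0 ((ℓ : ℝ) - cycD (j + 1)) with h | h
    · rw [max_eq_right h]; have := le_max_right 0 ((ℓ : ℝ) - cycD j); linarith
    · rw [max_eq_left h]; have := le_max_left 0 ((ℓ : ℝ) - cycD j); linarith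

omit [NeZero N] in
/-- Off the window the tent vanishes: `ℓ ≤ cycD j ⟹ tent j = 0`. [folklore] -/
theorem tent_eq_zero_of {ℓ : ℕ} {j : ZMod N} (h : ℓ ≤ cycD j) : tent ℓ j = 0 := by
  unfold tent
  have hh : (ℓ : ℝ) ≤ cycD j := by exact_mod_cast h
  exact max_eq_left (by linarith)

omit [NeZero N] in
/-- On the window the tent is bounded by `ℓ`: `tent j ≤ ℓ`, and `tent j ≠ 0 ⟹ cycD j < ℓ`. [folklore] -/
theorem tent_le (ℓ : ℕ) (j : ZMod N) : tent ℓ j ≤ ℓ ∧ (tent ℓ j ≠ 0 → cycD j < ℓ) := by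
  have h0 := Nat.cast_nonneg (α := ℝ) (cycD j)
  refine ⟨max_le (Nat.cast_nonneg _) (by linarith), fun h => ?_⟩
  by_contra hc
  exact h (tent_eq_zero_of (not_lt.mp hc))

omit [NeZero N] in
/-- At the sites `i < ℓ ≤ N∕2`: `tent(i) = ℓ − i`. [folklore] -/
theorem tent_natCast {ℓ i : ℕ} (hℓ : ℓ ≤ N / 2) (hi : i < ℓ) : tent ℓ (i : ZMod N) = (ℓ : ℝ) - i := by
  unfold tent
  rw [cycD_natCast (by omega)]
  have hh : (i : ℝ) ≤ ℓ := by exact_mod_cast hi.le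
  exact max_eq_right (by linarith)

/-- ★ `3·Σ_{i<ℓ}(i+1)² ≥ ℓ³`. [folklore] -/
theorem sum_succ_sq_ge (ℓ : ℕ) : (ℓ : ℝ) ^ 3 ≤ 3 * ∑ i ∈ Finset.range ℓ, ((i : ℝ) + 1) ^ 2 := by
  induction ℓ with
  | zero => simp
  | succ k ih => rw [Finset.sum_range_succ]; push_cast; nlinarith [ih, Nat.cast_nonneg (α := ℝ) k, sq_nonneg (k : ℝ)]

/-- ★ `3·Σ_{i<ℓ}(ℓ−i)² ≥ ℓ³` (reflection of the previous). [folklore] -/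
theorem sum_sq_sub_ge (ℓ : ℕ) : (ℓ : ℝ) ^ 3 ≤ 3 * ∑ i ∈ Finset.range ℓ, ((ℓ : ℝ) - i) ^ 2 := by
  have h := Finset.sum_range_reflect (fun i => ((ℓ : ℝ) - i) ^ 2) ℓ
  have h2 : ∑ j ∈ Finset.range ℓ, ((ℓ : ℝ) - ((ℓ - 1 - j : ℕ) : ℝ)) ^ 2 = ∑ j ∈ Finset.range ℓ, ((j : ℝ) + 1) ^ 2 := by
    refine Finset.sum_congr rfl fun j hj => ?_
    have hj' : j + 1 ≤ ℓ := Finset.mem_range.mp hj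
    have : ((ℓ - 1 - j : ℕ) : ℝ) = (ℓ : ℝ) - 1 - j := by
      rw [Nat.cast_sub (by omega), Nat.cast_sub (by omega)]; push_cast; ring
    rw [this]; ring
  rw [← h, h2]
  exact sum_succ_sq_ge ℓ

/-- ★ **THE TENT HAS MASS `≥ ℓ³∕3`** (`ℓ ≤ N∕2`, from the sites `0, 1, …, ℓ−1` alone). [folklore] -/
theorem sum_tent_sq_ge {ℓ : ℕ} (hℓ : ℓ ≤ N / 2) : (ℓ : ℝ) ^ 3 / 3 ≤ ∑ j : ZMod N, tent ℓ j ^ 2 := by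
  have hN : 0 < N := Nat.pos_of_ne_zero (NeZero.ne N)
  have hinj : Set.InjOn (fun i : ℕ => (i : ZMod N)) (Finset.range ℓ : Set ℕ) := by
    intro i hi i' hi' h
    have hi2 : i < N := by have := Finset.mem_range.mp hi; omega
    have hi2' : i' < N := by have := Finset.mem_range.mp hi'; omega
    have := congrArg ZMod.val h
    rwa [ZMod.val_natCast_of_lt hi2, ZMod.val_natCast_of_lt hi2'] at this
  have hsub : ∑ i ∈ Finset.range ℓ, tent ℓ ((i : ℕ) : ZMod N) ^ 2 ≤ ∑ j : ZMod N, tent ℓ j ^ 2 := by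
    rw [← Finset.sum_image (f := fun j : ZMod N => tent ℓ j ^ 2) hinj]
    exact Finset.sum_le_sum_of_subset_of_nonneg (Finset.subset_univ _) fun _ _ _ => sq_nonneg _
  have heq : ∑ i ∈ Finset.range ℓ, tent ℓ ((i : ℕ) : ZMod N) ^ 2 = ∑ i ∈ Finset.range ℓ, ((ℓ : ℝ) - i) ^ 2 :=
    Finset.sum_congr rfl fun i hi => by rw [tent_natCast hℓ (Finset.mem_range.mp hi)]
  have h3 := sum_sq_sub_ge ℓ
  rw [← heq] at h3
  linarith

/-- ★ **THE TENT HAS KINETIC ENERGY `≤ 2ℓ + 1`**: `Σ_j(tent(j+1) − tent j)² ≤ #{j : cycD j ≤ ℓ} ≤ 2ℓ+1`. [folklore] -/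
theorem sum_tent_fwdDiff_sq_le (ℓ : ℕ) : ∑ j : ZMod N, (tent ℓ (j + 1) - tent ℓ j) ^ 2 ≤ 2 * (ℓ : ℝ) + 1 := by
  classical
  -- outside the window `cycD j ≤ ℓ` both tent values vanish
  set W : Finset (ZMod N) := Finset.univ.filter (fun j => cycD j ≤ ℓ) with hW
  have hzero : ∀ j : ZMod N, j ∉ W → (tent ℓ (j + 1) - tent ℓ j) ^ 2 = 0 := by
    intro j hj
    have hj' : ℓ < cycD j := by simpa [hW] using hj
    rw [tent_eq_zero_of hj'.le, tent_eq_zero_of (by have := cycD_le_succ j; omega), sub_zero]; ring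
  have hle1 : ∀ j : ZMod N, (tent ℓ (j + 1) - tent ℓ j) ^ 2 ≤ 1 := fun j => by
    have h := abs_tent_succ_sub_le ℓ j
    have : (tent ℓ (j + 1) - tent ℓ j) ^ 2 = |tent ℓ (j + 1) - tent ℓ j| ^ 2 := (sq_abs _).symm
    rw [this]; nlinarith [abs_nonneg (tent ℓ (j + 1) - tent ℓ j)]
  -- the window has at most `2ℓ+1` points: it lies in the image of `[−ℓ, ℓ] ⊂ ℤ`
  have hcard : (W.card : ℝ) ≤ 2 * ℓ + 1 := by
    have hsubset : W ⊆ (Finset.Icc (-(ℓ : ℤ)) ℓ).image (fun k : ℤ => (k : ZMod N)) := by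
      intro j hj
      have hj' : cycD j ≤ ℓ := by simpa [hW] using hj
      refine Finset.mem_image.mpr ⟨j.valMinAbs, Finset.mem_Icc.mpr ?_, ZMod.coe_valMinAbs j⟩
      have : (j.valMinAbs.natAbs : ℤ) ≤ ℓ := by exact_mod_cast hj'
      rw [Int.natCast_natAbs] at this
      exact abs_le.mp this
    have h1 := (Finset.card_le_card hsubset).trans Finset.card_image_le
    rw [Int.card_Icc] at h1
    have h2 : ((ℓ : ℤ) + 1 - -(ℓ : ℤ)).toNat = 2 * ℓ + 1 := by omega
    rw [h2] at h1
    exact_mod_cast h1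
  calc ∑ j : ZMod N, (tent ℓ (j + 1) - tent ℓ j) ^ 2 = ∑ j ∈ W, (tent ℓ (j + 1) - tent ℓ j) ^ 2 := by
        rw [← Finset.sum_subset (Finset.subset_univ W) fun j _ hj => hzero j hj]
    _ ≤ ∑ _j ∈ W, (1 : ℝ) := Finset.sum_le_sum fun j _ => hle1 j
    _ = W.card := by simp
    _ ≤ 2 * ℓ + 1 := hcard

/-- ★ **THE POTENTIAL ENERGY OF THE TENT IS `≤ θ²ℓ²` TIMES ITS MASS**: `Σ_j(2 − 2Re ψ(p₀j))·tent(j)² ≤ θ²ℓ²·Σ_j tent(j)²` (the tent lives where `cycD < ℓ`). [cite: King1986, (2.12) p.653] -/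
theorem sum_potential_tent_sq_le (ℓ : ℕ) (p₀ : ZMod N) {θ : ℝ} (hθ : (ZMod.stdAddChar (N := N)) p₀ = Complex.exp (θ * Complex.I)) :
    ∑ j : ZMod N, (2 - 2 * ((ZMod.stdAddChar (N := N)) (p₀ * j) : ℂ).re) * tent ℓ j ^ 2 ≤ θ ^ 2 * (ℓ : ℝ) ^ 2 * ∑ j : ZMod N, tent ℓ j ^ 2 := by
  rw [Finset.mul_sum]
  refine Finset.sum_le_sum fun j _ => ?_
  by_cases h : tent ℓ j = 0
  · rw [h]; simp
  · have hlt : (cycD j : ℝ) < ℓ := by exact_mod_cast (tent_le ℓ j).2 h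
    have h1 := two_sub_two_re_stdAddChar_le p₀ j hθ
    have h2 : θ ^ 2 * (cycD j : ℝ) ^ 2 ≤ θ ^ 2 * (ℓ : ℝ) ^ 2 :=
      mul_le_mul_of_nonneg_left (pow_le_pow_left₀ (Nat.cast_nonneg _) hlt.le 2) (sq_nonneg _)
    exact mul_le_mul_of_nonneg_right (h1.trans h2) (sq_nonneg _)

end Tent

end Summit.QuantumFields.YangMills.BalabanUVNodes.N15KingModelRung.Landau

end
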